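import Mathlib
import Summits.ResolutionOfSingularities.ResolutionOfSingularities.Theorems.WeightedInvariantLocalWeightedDropWildMonicMaxFlagClose
import Summits.ResolutionOfSingularities.ResolutionOfSingularities.Theorems.WeightedInvariantLocalWeightedDropWildMonicFlagShearSetting
import Summits.ResolutionOfSingularities.ResolutionOfSingularities.Theorems.WeightedInvariantLocalWeightedDropWildMonicFlagCorner

/-!
# `WeightedInvariant.LocalWeightedDrop`, line `hasse-ridge-face-selection`, S3ρ sub-stub S3ρD `stub_wildMonicSurfaceDescent`: item D-0
# «maximising flag», (3h)-b — THE LOW-SHEAR LEMMA `ŝ = δ!·ord h`: a plane shear strictly BELOW the `s`-line makes the second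
# coefficient-ideal order EXACTLY `δ!·ord h` (Perlega Lemma 5.1.1 (3) one level down, the first step of Lemma 5.3.3 (3))

Crux item stmt-ResolutionOfSingularities-8899 `LocalWeightedDrop` (route `ResolutionOfSingularities/WeightedInvariant`), engine of the door
`HypersurfaceCentreConstruction` stmt-ResolutionOfSingularities-19897.  [OURS · L1 W4.3, chain w43, res-D-pv-056 AS res-L1-w43-stub-5 — first
brick of the hypothesis `h3h` of `exists_isGreatest_sFlag_pair_of` (…WildMonicFlagAttainPair; design memo = evidence #57 on stmt-8899).
MODEL: S. Perlega, *A new proof for the embedded resolution of surface singularities*, arXiv:2011.14443, Ch. 5 §3, proof of Lemma 5.3.3 (3)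
(p0064 L66–L71): «If `ord h ≥ s/d!` … So we can assume that `ord h < s/d!` and `ŝ = d!·ord h < s` by Lemma (m_under_coord_changes) (3)»
— Lemma 5.1.1 (3) for the weight `(1, ord h)` applied to `I₋₁ ⊂ K[[x, z]]` under `z ↦ z + h(x)`.  Nothing here is a statement of
H. Hironaka's manuscript [claim: Hironaka2017, status: under-review]; every object is OURS.]

THE POINT-SET MECHANISM.  Flag tuple `A`, boundary `E` with `1 ∉ E` (so `r₁ = 0` and the shear keeps `(δ, r)`:
`dRes_shear_eq` / `excExp_shear_eq`, stub-3), reduced scaled points `P = N_i·e − r` of the monomials `e` of the slots `A_i`,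
`δ = dRes`, `s = sFlag`, shear `θ_H : x₁ ↦ x₁ + H(x₀)` with `η = ord H ≥ 1` and leading coefficient `c`.
* `mul_sub_lt_redPt_of_lt_sFlag` — if `δ!·η < s` then below the row `δ` every reduced point has `η·(δ − P₁) < P₀` (the standing
  inequality `s·(δ − P₁) ≤ δ!·P₀`, `sFlag_mul_le`); hence `mul_dRes_le_redPt`: `η·δ ≤ P₀ + η·P₁` for EVERY monomial, and
  `redPt_eq_of_le_mul_dRes`: equality only at the CORNER `(0, δ)`; `exists_redPt_corner` — when `δ! < s` the corner IS a reduced point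
  (the point realising `δ = min (P₀ + P₁)` cannot lie below the row `δ`, for it would give `s ≤ δ!`).
* `coeff_mul_pow_of_order_eq` — `[x^{η·b}] H^b = c^b`; `coeff_subst_shift_of_isMin` — if `(a, b)` is the least exponent of `G` for the
  weight `(1, η)`, unique in its row sense, then `[x₀^{a + η·b}] θ_H^* G = c^b · [x₀^a x₁^b] G` (row formula `coeff_subst_shift_eq_sum`).
* **`sFlag_shear_eq_mul_order`** — for `0 < δ` and `δ!·ord H < s`: `sFlag E (newtonSet (θ_H^* A)) = δ!·ord H`.  LOWER bound: stub-3's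
  `le_sFlag_shear_of_not_mem` (a shear with `s′ ≤ δ!·ord H` does not push `sFlag ≥ s′` below `s′`).  UPPER bound: the corner monomial
  `x₀^{a} x₁^{b}` (`N_i·a = r₀`, `N_i·b = δ`) of some slot yields in `θ_H^* A_i` the monomial `x₀^{a + η·b}` with coefficient
  `c^b·[x₀^a x₁^b] A_i ≠ 0`, whose reduced point is `(η·δ, 0)`; by `natCast_le_sFlag_iff` this point forbids `δ!·η + 1 ≤ sFlag`.
-/

set_option linter.dupNamespace false -- mandated namespace of this single-conjunct summit

noncomputable section

namespace Summit.ResolutionOfSingularities.ResolutionOfSingularities.Theorems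

namespace WildMonic

open MvPowerSeries MonicDescent

variable {k : Type} [Field k] {d : ℕ}

/-! ## The corner of the reduced set below a low line -/

section Corner

variable {E : Finset (Fin 2)} (A : Fin d → MvPowerSeries (Fin 2) k)

/-- If `δ!·η < s` then below the row `δ` every monomial's reduced scaled point satisfies `η·(δ − P₁) < P₀`
(from the standing inequality `s·(δ − P₁) ≤ δ!·P₀`). -/
theorem mul_sub_lt_redPt_of_lt_sFlag {η : ℕ}
    (hη : (((dRes E (newtonSet A)).factorial * η : ℕ) : ℕ∞) < sFlag E (newtonSet A))
    (i : Fin d) {e : Fin 2 →₀ ℕ} (he : coeff e (A i) ≠ 0) (h1 : redPt A E i e 1 < dRes E (newtonSet A)) :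
    η * (dRes E (newtonSet A) - redPt A E i e 1) < redPt A E i e 0 := by
  have hle : (((dRes E (newtonSet A)).factorial * η + 1 : ℕ) : ℕ∞) ≤ sFlag E (newtonSet A) := by
    rw [Nat.cast_succ]
    exact ENat.coe_add_one_le_iff.2 hη
  have h := (natCast_le_sFlag_iff E A _).1 hle i e he
  set δ := dRes E (newtonSet A)
  set P := redPt A E i e
  set K := δ.factorial * η + 1 with hK
  have h2 : K * P 1 ≤ K * δ := Nat.mul_le_mul_left K h1.le
  have h3 : K * (δ - P 1) ≤ δ.factorial * P 0 := by rw [Nat.mul_sub]; omega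
  have h4 : K * (δ - P 1) = δ.factorial * (η * (δ - P 1)) + (δ - P 1) := by rw [hK]; ring
  have h5 : 0 < δ - P 1 := by omega
  have h6 : δ.factorial * (η * (δ - P 1)) < δ.factorial * P 0 := by omega
  exact Nat.lt_of_mul_lt_mul_left h6

/-- Hence `η·δ ≤ P₀ + η·P₁` for EVERY monomial: the reduced set lies on or above the line of slope `−1/η` through the corner `(0, δ)`. -/
theorem mul_dRes_le_redPt {η : ℕ}
    (hη : (((dRes E (newtonSet A)).factorial * η : ℕ) : ℕ∞) < sFlag E (newtonSet A))
    (i : Fin d) {e : Fin 2 →₀ ℕ} (he : coeff e (A i) ≠ 0) :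
    η * dRes E (newtonSet A) ≤ redPt A E i e 0 + η * redPt A E i e 1 := by
  by_cases h1 : redPt A E i e 1 < dRes E (newtonSet A)
  · have h := mul_sub_lt_redPt_of_lt_sFlag A hη i he h1
    set δ := dRes E (newtonSet A)
    set P := redPt A E i e
    rw [Nat.mul_sub] at h
    have h2 : η * P 1 ≤ η * δ := Nat.mul_le_mul_left η h1.le
    omega
  · set δ := dRes E (newtonSet A)
    set P := redPt A E i e
    have h2 : η * δ ≤ η * P 1 := Nat.mul_le_mul_left η (not_lt.1 h1)
    omega

/-- And for `η > 0` equality `P₀ + η·P₁ = η·δ` holds ONLY at the corner `(0, δ)`. -/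
theorem redPt_eq_of_le_mul_dRes {η : ℕ}
    (hη : (((dRes E (newtonSet A)).factorial * η : ℕ) : ℕ∞) < sFlag E (newtonSet A)) (hpos : 0 < η)
    (i : Fin d) {e : Fin 2 →₀ ℕ} (he : coeff e (A i) ≠ 0)
    (hle : redPt A E i e 0 + η * redPt A E i e 1 ≤ η * dRes E (newtonSet A)) :
    redPt A E i e 0 = 0 ∧ redPt A E i e 1 = dRes E (newtonSet A) := by
  by_cases h1 : redPt A E i e 1 < dRes E (newtonSet A)
  · exfalso
    have h := mul_sub_lt_redPt_of_lt_sFlag A hη i he h1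
    set δ := dRes E (newtonSet A)
    set P := redPt A E i e
    rw [Nat.mul_sub] at h
    have h2 : η * P 1 ≤ η * δ := Nat.mul_le_mul_left η h1.le
    omega
  · set δ := dRes E (newtonSet A)
    set P := redPt A E i e
    have h2 : η * δ ≤ η * P 1 := Nat.mul_le_mul_left η (not_lt.1 h1)
    have h3 : η * P 1 ≤ η * δ := by omega
    exact ⟨by omega, le_antisymm (Nat.le_of_mul_le_mul_left h3 hpos) (not_lt.1 h1)⟩

/-- **THE CORNER EXISTS** when `δ! < s`: some monomial has reduced scaled point `(0, δ)` (the point realising `δ = min (P₀ + P₁)`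
cannot lie below the row `δ`, since there it would give `s ≤ δ!·P₀/(δ − P₁) ≤ δ!`). -/
theorem exists_redPt_corner (hs : (((dRes E (newtonSet A)).factorial : ℕ) : ℕ∞) < sFlag E (newtonSet A))
    (hN : (newtonSet A).Nonempty) :
    ∃ (i : Fin d) (e : Fin 2 →₀ ℕ), coeff e (A i) ≠ 0 ∧ redPt A E i e 0 = 0 ∧ redPt A E i e 1 = dRes E (newtonSet A) := by
  obtain ⟨Q, hQ, hQd⟩ := exists_eq_deltaL (reduce_nonempty (excExp E (newtonSet A)) hN)
  obtain ⟨P', ⟨i, e, he, rfl⟩, rfl⟩ := hQ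
  change redPt A E i e 0 + redPt A E i e 1 = dRes E (newtonSet A) at hQd
  have hs1 : (((dRes E (newtonSet A)).factorial * 1 : ℕ) : ℕ∞) < sFlag E (newtonSet A) := by rwa [mul_one]
  exact ⟨i, e, he, redPt_eq_of_le_mul_dRes A hs1 one_pos i he (by rw [one_mul, one_mul]; exact hQd.le)⟩

end Corner

/-! ## The corner coefficient under the shear -/

section Coefficient

/-- THE LEADING COEFFICIENT OF A POWER: `[x^{η·b}] φ^b = ([x^η] φ)^b` for `η = ord φ`. -/
theorem coeff_mul_pow_of_order_eq {φ : PowerSeries k} {η : ℕ} (hη : φ.order = η) (b : ℕ) :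
    PowerSeries.coeff (η * b) (φ ^ b) = PowerSeries.coeff η φ ^ b := by
  have h : φ.order.toNat = η := by rw [hη, ENat.toNat_coe]
  have hφ : φ ^ b = PowerSeries.X ^ (η * b) * PowerSeries.divXPowOrder φ ^ b := by
    conv_lhs => rw [← PowerSeries.X_pow_order_mul_divXPowOrder (f := φ), h]
    rw [mul_pow, ← pow_mul]
  rw [hφ, PowerSeries.coeff_X_pow_mul', if_pos le_rfl, Nat.sub_self, PowerSeries.coeff_zero_eq_constantCoeff_apply, map_pow,
    PowerSeries.constantCoeff_divXPowOrder, h]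

/-- **THE CORNER COEFFICIENT UNDER THE PLANE SHEAR.**  Let `η = ord H` and suppose the exponent `(a, b)` minimises `e₀ + η·e₁` over the
support of `G`, every minimiser having `e₁ = b`.  Then `θ_H^* G` has at `x₀^{a + η·b}` the coefficient `([x₀^η] H)^b · [x₀^a x₁^b] G`:
in the row formula only the row `b` and the split `a + η·b = η·b + a` survive. -/
theorem coeff_subst_shift_of_isMin {H : PowerSeries k} (hH : PowerSeries.constantCoeff H = 0) {η : ℕ} (hη : H.order = η)
    (G : MvPowerSeries (Fin 2) k) {a b : ℕ}
    (hmin : ∀ e : Fin 2 →₀ ℕ, coeff e G ≠ 0 → a + η * b ≤ e 0 + η * e 1)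
    (huniq : ∀ e : Fin 2 →₀ ℕ, coeff e G ≠ 0 → e 0 + η * e 1 = a + η * b → e 1 = b) :
    coeff (Finsupp.single 0 (a + η * b)) (subst (PurePowerFlag.shift H) G) =
      PowerSeries.coeff η H ^ b * coeff (Finsupp.single 0 a + Finsupp.single 1 b) G := by
  have hη1 : 1 ≤ η := by
    have h1 := one_le_order_of_constantCoeff hH
    rw [hη] at h1
    exact_mod_cast h1
  rw [show (Finsupp.single 0 (a + η * b) : Fin 2 →₀ ℕ) = Finsupp.single 0 (a + η * b) + Finsupp.single 1 0 by
    rw [Finsupp.single_zero, add_zero], coeff_subst_shift_eq_sum hH]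
  simp only [zero_add, Nat.choose_zero_right, Nat.cast_one, one_mul]
  rw [Finset.sum_eq_single b]
  · -- the row `b`: only the split `(η·b, a)` of `a + η·b` contributes
    rw [PowerSeries.coeff_mul, Finset.sum_eq_single (η * b, a)]
    · rw [PowerSeries.coeff_mk, coeff_mul_pow_of_order_eq hη]
    · rintro ⟨u, v⟩ huv hne
      rw [Finset.HasAntidiagonal.mem_antidiagonal] at huv
      rcases lt_or_ge u (η * b) with hu | hu
      · rw [PowerSeries.coeff_of_lt_order u (by rw [PowerSeries.order_pow, nsmul_eq_mul, hη, mul_comm]; exact_mod_cast hu), zero_mul]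
      · rw [PowerSeries.coeff_mk]
        by_cases hv : coeff (Finsupp.single 0 v + Finsupp.single 1 b) G = 0
        · rw [hv, mul_zero]
        · exfalso
          have h := hmin _ hv
          rw [pt_apply_zero, pt_apply_one] at h
          apply hne
          change u + v = a + η * b at huv
          ext
          · change u = η * b; omega
          · change v = a; omega
    · intro h
      exact absurd (Finset.HasAntidiagonal.mem_antidiagonal.2 (by change η * b + a = a + η * b; ring)) h
  · -- the other rows vanish at `x₀^{a + η·b}`
    intro j _ hjb
    by_contra hne
    obtain ⟨u, v, huv, hu, hv⟩ := exists_of_coeff_pow_mul_ne_zero hne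
    rw [PowerSeries.coeff_mk] at hv
    have h := hmin _ hv
    rw [pt_apply_zero, pt_apply_one] at h
    rw [hη] at hu
    have hu' : j * η ≤ u := by exact_mod_cast hu
    have hu'' : η * j ≤ u := by rwa [Nat.mul_comm] at hu'
    have heq : v + η * j = a + η * b := by omega
    have hj := huniq _ hv (by rw [pt_apply_zero, pt_apply_one]; exact heq)
    rw [pt_apply_one] at hj
    exact hjb hj
  · intro hb
    exfalso
    exact hb (Finset.mem_range.2 (by nlinarith [Nat.le_mul_of_pos_left b hη1]))

end Coefficient

/-! ## The low-shear lemma -/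

section Shear

variable {E : Finset (Fin 2)}

/-- **THE LOW-SHEAR LEMMA** (Per17 Lemma 5.1.1 (3) one level down; the step «`ord h < s/d!` ⇒ `ŝ = d!·ord h < s`» of the proof of
Lemma 5.3.3 (3)).  Let `x₁` not be a boundary letter, `δ = dRes > 0`, and let the shear `θ_H : x₁ ↦ x₁ + H(x₀)` lie strictly BELOW the
`s`-line: `δ!·ord H < s = sFlag`.  Then `sFlag E (newtonSet (θ_H^* A)) = δ!·ord H`.
[cite: Perlega2020, Lemma 5.1.1 (3) & proof of Lemma 5.3.3 (3) (arXiv:2011.14443 Ch. 5 §1 p0058; §3 p0064 L66–L71)] -/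
theorem sFlag_shear_eq_mul_order (hE : (1 : Fin 2) ∉ E) (A : Fin d → MvPowerSeries (Fin 2) k) {H : PowerSeries k}
    (hH : PowerSeries.constantCoeff H = 0) (hδ : 0 < dRes E (newtonSet A))
    (hlow : ((dRes E (newtonSet A)).factorial : ℕ∞) * H.order < sFlag E (newtonSet A)) :
    sFlag E (newtonSet (fun i => subst (PurePowerFlag.shift H) (A i))) = ((dRes E (newtonSet A)).factorial : ℕ∞) * H.order := by
  have hr' := excExp_shear_eq hE hH A
  have hδ' := dRes_shear_eq hE hH A
  set T : Fin d → MvPowerSeries (Fin 2) k := fun i => subst (PurePowerFlag.shift H) (A i) with hT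
  set δ := dRes E (newtonSet A) with hδdef
  -- `H ≠ 0`, `η = ord H ≥ 1`, leading coefficient `c ≠ 0`
  have hHne : H ≠ 0 := by
    rintro rfl
    rw [PowerSeries.order_zero, ENat.mul_top (by exact_mod_cast (Nat.factorial_pos δ).ne')] at hlow
    exact not_top_lt hlow
  obtain ⟨η, hη⟩ : ∃ η : ℕ, H.order = η := by
    obtain ⟨η, hη⟩ := ENat.ne_top_iff_exists.mp (by rwa [Ne, PowerSeries.order_eq_top] : H.order ≠ ⊤)
    exact ⟨η, hη.symm⟩
  rw [hη] at hlow ⊢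
  have hlow' : ((δ.factorial * η : ℕ) : ℕ∞) < sFlag E (newtonSet A) := by push_cast; exact hlow
  have hη1 : 1 ≤ η := by
    have h1 := one_le_order_of_constantCoeff hH
    rw [hη] at h1
    exact_mod_cast h1
  have hc : PowerSeries.coeff η H ≠ 0 := by
    have h := PowerSeries.coeff_order hHne
    rwa [hη, ENat.toNat_coe] at h
  refine le_antisymm ?_ ?_
  · -- UPPER BOUND: the corner monomial survives the shear as `x₀^{a + η b}` with reduced point `(η δ, 0)`
    have hN : (newtonSet A).Nonempty := newtonSet_nonempty_of_dRes_pos E A hδ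
    have hs : ((δ.factorial : ℕ) : ℕ∞) < sFlag E (newtonSet A) :=
      lt_of_le_of_lt (by exact_mod_cast Nat.le_mul_of_pos_right δ.factorial hη1) hlow'
    obtain ⟨i, e, he, hP0, hP1⟩ := exists_redPt_corner A hs hN
    have hr1 : excExp E (newtonSet A) 1 = 0 := excExp_eq_zero_of_not_mem hE
    have he1 : slotWeight d i * e 1 = δ := by rw [redPt_apply, hr1, Nat.sub_zero] at hP1; exact hP1
    have he0 : slotWeight d i * e 0 = excExp E (newtonSet A) 0 := by
      rw [redPt_apply] at hP0
      have h0 := excExp_le (E := E) (smul_mem_newtonSet A i he) 0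
      simp only [Finsupp.smul_apply, smul_eq_mul] at h0
      omega
    have hNe : slotWeight d i * (e 0 + η * e 1) = excExp E (newtonSet A) 0 + η * δ := by
      rw [mul_add, mul_left_comm, he0, he1]
    -- the corner coefficient of the sheared slot
    have hcoef : coeff (Finsupp.single 0 (e 0 + η * e 1)) (T i) = PowerSeries.coeff η H ^ (e 1) * coeff e (A i) := by
      have h := coeff_subst_shift_of_isMin hH hη (A i) (a := e 0) (b := e 1) ?_ ?_
      · rwa [InsepNewton.coeff_single_add_single_eq e] at h
      · intro e' he'
        have h := mul_dRes_le_redPt A hlow' i he'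
        have h0 := excExp_le (E := E) (smul_mem_newtonSet A i he') 0
        simp only [Finsupp.smul_apply, smul_eq_mul] at h0
        rw [redPt_apply, redPt_apply, hr1, Nat.sub_zero] at h
        have hNe' : slotWeight d i * (e' 0 + η * e' 1) = slotWeight d i * e' 0 + η * (slotWeight d i * e' 1) := by ring
        have key : slotWeight d i * (e 0 + η * e 1) ≤ slotWeight d i * (e' 0 + η * e' 1) := by
          rw [hNe, hNe']
          rw [← hδdef] at h
          omega
        exact Nat.le_of_mul_le_mul_left key (slotWeight_pos i)
      · intro e' he' heq
        have h0 := excExp_le (E := E) (smul_mem_newtonSet A i he') 0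
        simp only [Finsupp.smul_apply, smul_eq_mul] at h0
        have hNe' : slotWeight d i * (e' 0 + η * e' 1) = slotWeight d i * e' 0 + η * (slotWeight d i * e' 1) := by ring
        have hw : slotWeight d i * e' 0 + η * (slotWeight d i * e' 1) = excExp E (newtonSet A) 0 + η * δ := by
          rw [← hNe', heq, hNe]
        have hc' := redPt_eq_of_le_mul_dRes A hlow' (by omega) i he'
          (by rw [redPt_apply, redPt_apply, hr1, Nat.sub_zero, ← hδdef]; omega)
        have h1' : slotWeight d i * e' 1 = δ := by
          have h2 := hc'.2
          rw [redPt_apply, hr1, Nat.sub_zero] at h2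
          exact h2
        exact Nat.eq_of_mul_eq_mul_left (slotWeight_pos i) (h1'.trans he1.symm)
    have hne' : coeff (Finsupp.single 0 (e 0 + η * e 1)) (T i) ≠ 0 := by
      rw [hcoef]
      exact mul_ne_zero (pow_ne_zero _ hc) he
    -- its reduced scaled point is `(η δ, 0)`
    have hQ0 : redPt T E i (Finsupp.single 0 (e 0 + η * e 1)) 0 = η * δ := by
      rw [redPt_apply, hr', Finsupp.single_eq_same, hNe, Nat.add_sub_cancel_left]
    have hQ1 : redPt T E i (Finsupp.single 0 (e 0 + η * e 1)) 1 = 0 := by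
      rw [redPt_apply, hr', hr1, Finsupp.single_eq_of_ne (by decide), mul_zero, Nat.sub_zero]
    -- so `δ!·η + 1 ≤ sFlag (θ_H^* A)` is impossible
    by_contra hgt
    rw [not_le] at hgt
    have hge : (((δ.factorial * η + 1 : ℕ)) : ℕ∞) ≤ sFlag E (newtonSet T) := by
      rw [Nat.cast_succ]
      exact ENat.coe_add_one_le_iff.2 (by push_cast; exact hgt)
    have h := (natCast_le_sFlag_iff E T (δ.factorial * η + 1)).1 hge i _ hne'
    rw [hδ', hQ0, hQ1, mul_zero, add_zero] at h
    have h2 : (δ.factorial * η + 1) * δ = δ.factorial * (η * δ) + δ := by ring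
    omega
  · -- LOWER BOUND: a shear with `δ!·η ≤ δ!·ord H` does not push `sFlag ≥ δ!·η` below `δ!·η`
    have h := le_sFlag_shear_of_not_mem hE A hH (s := δ.factorial * η) hlow'.le (by push_cast; rw [hη])
    push_cast at h
    exact h

end Shear

end WildMonic

end Summit.ResolutionOfSingularities.ResolutionOfSingularities.Theorems

end
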